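import Literature.Topology.FourManifolds.TracePolarRigid
import Literature.Topology.FourManifolds.AmbientIsotopyFamily
import Literature.Topology.FourManifolds.EuclideanIsotopyExtension
import Literature.Topology.FourManifolds.SPC4HandlesCancelStep
import Literature.Topology.FourManifolds.ClosedBall
import HarnessLib

/-!
# Straightening a boundary diffeomorphism along the trace circles (the circle step)

Topic `Literature/Topology/FourManifolds` (support file for the Torelli half of Griffiths'
handlebody theorem, `stmt-SmoothPoincare4-15190`, after `TracePolarRigid.lean`).
Everything here is **proved**; the definitions are the circle maps of a boundary
diffeomorphism in flow-polar coordinates.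

Griffiths, *Automorphisms of a 3-dimensional handlebody* (1964), §3, and Hirsch,
*Differential Topology* (1976), Ch. 8 §1 Thm. 1.3, §3 Thm. 3.3: a diffeomorphism of the
boundary surface carrying a meridian circle onto a meridian circle is, *along the circle*, a
diffeomorphism of `S¹`, isotopic to the identity or to a reflection; the isotopy extends to an
ambient isotopy of the surface supported near the image circle.  For a pair of basin settings
`P` with saddle data `Q` on a compact `3`-manifold with boundary (all saddles of index `1`) and
a boundary diffeomorphism `χ` carrying the `ξ_A`-trace of every saddle `s` onto the `ξ_B`-trace
of `σ s`:

* `SaddleData.circleDiffeo Q hk χ hχ s : 𝕊¹ ≃ₘ 𝕊¹` — `χ` along the trace of `s`, read in the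
  flow-polar charts `Q.pol s` and `Q.swap.pol (σ s)` (`TracePolarChart.lean`,
  `TracePolarTrace.lean`);
* `SaddleData.exists_ambientIsotopy_circleStraighten` — **if every circle map is isotopic to
  the identity, there is an ambient isotopy `Ψ` of `∂W`, supported in the (pairwise disjoint)
  sources of the charts `Q.swap.pol s'`, with `Ψ₁ (pol'_{σ s} u) = χ (pol_s u)` for every unit
  vector `u` and every saddle `s`** (isotopy extension theorem with support,
  `exists_ambientIsotopy_comp_eq_of_subset`, applied saddle by saddle and composed,
  `AmbientIsotopyFamily.lean`).  Consequently `Ψ₁⁻¹ ∘ χ` is the identity in flow-polar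
  coordinates *on* every trace circle — the input of the normal straightening (sequel).

## References

* H. B. Griffiths, *Automorphisms of a 3-dimensional handlebody*, Abh. Math. Sem. Univ. Hamburg
  26 (1964), §3. [GriffithsHB1964Handlebody]
* M. W. Hirsch, *Differential Topology*, GTM 33 (1976), Ch. 8 §1, Thm. 1.3; §3, Thm. 3.3.
  [HirschDT1976]
-/

open scoped Manifold ContDiff Topology
open Set Function Filter Metric

noncomputable section

namespace Literature.Topology.FourManifolds

open Cobordism FourManifolds.Flow TracePolar

universe u

namespace BasinPair

namespace SaddleData

attribute [local instance] fact_finrank_euclideanSpace_succ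

variable {W : Type u} [TopologicalSpace W] [T2Space W] [SecondCountableTopology W]
  [CompactSpace W] [ChartedSpace (EuclideanHalfSpace (2 + 1)) W] [IsManifold (𝓡∂ (2 + 1)) ∞ W]
  {g : W → ℝ} {ξA ξB : Π x : W, TangentSpace (𝓡∂ (2 + 1)) x} {P : BasinPair g ξA ξB}
  (Q : P.SaddleData)

/-- Local notation for the model plane. -/
local notation "E2" => EuclideanSpace ℝ (Fin 2)

/-! ### The flow-polar chart restricted to the unit circle is an embedding -/

variable {Q}

/-- A unit vector lies in the flow-polar target. [folklore] -/
theorem coe_sphere_mem_polTarget (u : Metric.sphere (0 : E2) 1) : (u : E2) ∈ Q.polTarget :=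
  Q.mem_polTarget_of_norm_eq_one (by simp)

/-- **The differential of the flow-polar map is injective on the target** (it has the smooth
left inverse `polInv` there). [folklore] -/
theorem mfderiv_pol_injective [Nonempty (BoundaryManifold.boundaryData 2 W).carrier] {s : SaddlePt 2 g}
    (hk : (Q.DA s).k = 1) {w : E2} (hw : w ∈ Q.polTarget) :
    Injective (mfderiv 𝓘(ℝ, E2) (𝓡 2) (Q.pol s) w) := by
  have hpol : MDifferentiableAt 𝓘(ℝ, E2) (𝓡 2) (Q.pol s) w := (contMDiffAt_pol hk hw).mdifferentiableAt (by simp)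
  have hinv : MDifferentiableAt (𝓡 2) 𝓘(ℝ, E2) (Q.polInv s) (Q.pol s w) :=
    (contMDiffAt_polInv hk (pol_mem_polSource hk hw)).mdifferentiableAt (by simp)
  have hev : (Q.polInv s ∘ Q.pol s) =ᶠ[𝓝 w] id :=
    Filter.eventuallyEq_of_mem (Q.isOpen_polTarget.mem_nhds hw) fun w' hw' => polInv_pol hk hw'
  have h1 : mfderiv 𝓘(ℝ, E2) 𝓘(ℝ, E2) (Q.polInv s ∘ Q.pol s) w =
      (mfderiv (𝓡 2) 𝓘(ℝ, E2) (Q.polInv s) (Q.pol s w)).comp (mfderiv 𝓘(ℝ, E2) (𝓡 2) (Q.pol s) w) :=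
    mfderiv_comp w hinv hpol
  rw [hev.mfderiv_eq, mfderiv_id] at h1
  have h3 : ∀ x : E2,
      (mfderiv (𝓡 2) 𝓘(ℝ, E2) (Q.polInv s) (Q.pol s w)) ((mfderiv 𝓘(ℝ, E2) (𝓡 2) (Q.pol s) w) x) = x := fun x => by
    have h := congrArg (fun L : TangentSpace 𝓘(ℝ, E2) w →L[ℝ] TangentSpace 𝓘(ℝ, E2) w => L x) h1
    exact h.symm
  intro v v' hvv'
  have h := congrArg (mfderiv (𝓡 2) 𝓘(ℝ, E2) (Q.polInv s) (Q.pol s w)) hvv'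
  rwa [h3, h3] at h

variable [Nonempty (BoundaryManifold.boundaryData 2 W).carrier]

/-! ### The circle maps of a boundary diffeomorphism -/

section Circle

variable (Q)
variable (hk : ∀ s, (Q.DA s).k = 1) (χ : (𝓡∂ (2 + 1)).boundary W ≃ₘ⟮𝓡 2, 𝓡 2⟯ (𝓡∂ (2 + 1)).boundary W)
  (hχ : ∀ s y, χ y ∈ P.B.traceOf (Q.σ s) ↔ y ∈ P.A.traceOf s)

omit [Nonempty (BoundaryManifold.boundaryData 2 W).carrier] in
include hk in
/-- The index of the `B`-boxes is `1`. [folklore] -/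
theorem k_swap_eq_one (s' : SaddlePt 2 g) : (Q.swap.DA s').k = 1 := by
  have h := k_DB_eq_one (Q := Q) (hk (Q.σ.symm s'))
  rwa [Q.σ.apply_symm_apply] at h

omit [Nonempty (BoundaryManifold.boundaryData 2 W).carrier] in
include hχ in
/-- `χ⁻¹` carries the `ξ_B`-trace of `σ s` onto the `ξ_A`-trace of `s`. [folklore] -/
theorem symm_mem_traceOf_iff (s : SaddlePt 2 g) (y : (𝓡∂ (2 + 1)).boundary W) :
    χ.symm y ∈ P.A.traceOf s ↔ y ∈ P.B.traceOf (Q.σ s) := by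
  rw [← hχ s (χ.symm y), χ.apply_symm_apply]

/-- **The circle map of `χ` at `s`, as a map into the plane**: `u ↦ polInv'_{σ s} (χ (pol_s u))`. [cite: GriffithsHB1964Handlebody, §3] -/
def circleFun (s : SaddlePt 2 g) (u : Metric.sphere (0 : E2) 1) : E2 := Q.swap.polInv (Q.σ s) (χ (Q.pol s u))

/-- The inverse circle map, as a map into the plane: `u ↦ polInv_s (χ⁻¹ (pol'_{σ s} u))`. [folklore] -/
def circleInvFun (s : SaddlePt 2 g) (u : Metric.sphere (0 : E2) 1) : E2 := Q.polInv s (χ.symm (Q.swap.pol (Q.σ s) u))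

variable {Q χ}

include hk hχ in
/-- `χ` of a point of the trace circle of `s` lies on the trace circle of `σ s`, inside the
source of its chart. [folklore] -/
theorem apply_pol_mem (s : SaddlePt 2 g) (u : Metric.sphere (0 : E2) 1) :
    χ (Q.pol s u) ∈ P.B.traceOf (Q.σ s) ∧ χ (Q.pol s u) ∈ Q.swap.polSource (Q.σ s) := by
  have h1 : χ (Q.pol s u) ∈ P.B.traceOf (Q.σ s) := (hχ s _).2 (Q.pol_mem_traceOf (hk s) (by simp))
  exact ⟨h1, Q.swap.traceOf_subset_polSource (Q.σ s) h1⟩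

include hk hχ in
/-- `χ⁻¹` of a point of the trace circle of `σ s` lies on the trace circle of `s`, inside the
source of its chart. [folklore] -/
theorem symm_apply_pol_mem (s : SaddlePt 2 g) (u : Metric.sphere (0 : E2) 1) :
    χ.symm (Q.swap.pol (Q.σ s) u) ∈ P.A.traceOf s ∧ χ.symm (Q.swap.pol (Q.σ s) u) ∈ Q.polSource s := by
  have h0 : Q.swap.pol (Q.σ s) u ∈ P.B.traceOf (Q.σ s) := Q.swap.pol_mem_traceOf (k_swap_eq_one Q hk _) (by simp)
  have h1 : χ.symm (Q.swap.pol (Q.σ s) u) ∈ P.A.traceOf s := (symm_mem_traceOf_iff Q χ hχ s _).2 h0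
  exact ⟨h1, Q.traceOf_subset_polSource s h1⟩

include hk hχ in
/-- The circle map takes values on the unit circle. [folklore] -/
theorem norm_circleFun (s : SaddlePt 2 g) (u : Metric.sphere (0 : E2) 1) : ‖Q.circleFun χ s u‖ = 1 := by
  obtain ⟨h1, h2⟩ := apply_pol_mem hk hχ s u
  exact (Q.swap.norm_polInv_eq_one_iff (k_swap_eq_one Q hk _) h2).2 h1

include hk hχ in
/-- The inverse circle map takes values on the unit circle. [folklore] -/
theorem norm_circleInvFun (s : SaddlePt 2 g) (u : Metric.sphere (0 : E2) 1) : ‖Q.circleInvFun χ s u‖ = 1 := by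
  obtain ⟨h1, h2⟩ := symm_apply_pol_mem hk hχ s u
  exact (Q.norm_polInv_eq_one_iff (hk s) h2).2 h1

include hk hχ in
/-- `circleFun_mem`. [folklore] -/
theorem circleFun_mem (s : SaddlePt 2 g) (u : Metric.sphere (0 : E2) 1) : Q.circleFun χ s u ∈ Metric.sphere (0 : E2) 1 := by
  simpa using norm_circleFun hk hχ s u

include hk hχ in
/-- `circleInvFun_mem`. [folklore] -/
theorem circleInvFun_mem (s : SaddlePt 2 g) (u : Metric.sphere (0 : E2) 1) : Q.circleInvFun χ s u ∈ Metric.sphere (0 : E2) 1 := by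
  simpa using norm_circleInvFun hk hχ s u

include hk in
/-- The circle map into the plane is smooth. [folklore] -/
theorem contMDiff_circleFun (hχ : ∀ s y, χ y ∈ P.B.traceOf (Q.σ s) ↔ y ∈ P.A.traceOf s) (s : SaddlePt 2 g) :
    ContMDiff (𝓡 1) 𝓘(ℝ, E2) ∞ (Q.circleFun χ s) := by
  intro u
  have h1 : ContMDiffAt (𝓡 1) (𝓡 2) ∞ (fun u : Metric.sphere (0 : E2) 1 => Q.pol s u) u :=
    (contMDiffAt_pol (hk s) (coe_sphere_mem_polTarget u)).comp u contMDiff_coe_sphere.contMDiffAt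
  have h2 : ContMDiffAt (𝓡 1) (𝓡 2) ∞ (fun u : Metric.sphere (0 : E2) 1 => χ (Q.pol s u)) u :=
    χ.contMDiff.contMDiffAt.comp u h1
  exact (contMDiffAt_polInv (k_swap_eq_one Q hk _) (apply_pol_mem hk hχ s u).2).comp u h2

include hk in
/-- The inverse circle map into the plane is smooth. [folklore] -/
theorem contMDiff_circleInvFun (hχ : ∀ s y, χ y ∈ P.B.traceOf (Q.σ s) ↔ y ∈ P.A.traceOf s) (s : SaddlePt 2 g) :
    ContMDiff (𝓡 1) 𝓘(ℝ, E2) ∞ (Q.circleInvFun χ s) := by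
  intro u
  have h1 : ContMDiffAt (𝓡 1) (𝓡 2) ∞ (fun u : Metric.sphere (0 : E2) 1 => Q.swap.pol (Q.σ s) u) u :=
    (contMDiffAt_pol (k_swap_eq_one Q hk _) (coe_sphere_mem_polTarget u)).comp u contMDiff_coe_sphere.contMDiffAt
  have h2 : ContMDiffAt (𝓡 1) (𝓡 2) ∞ (fun u : Metric.sphere (0 : E2) 1 => χ.symm (Q.swap.pol (Q.σ s) u)) u :=
    χ.symm.contMDiff.contMDiffAt.comp u h1
  exact (contMDiffAt_polInv (hk s) (symm_apply_pol_mem hk hχ s u).2).comp u h2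

include hk hχ in
/-- The two circle maps are mutually inverse. [folklore] -/
theorem circleInvFun_circleFun (s : SaddlePt 2 g) (u : Metric.sphere (0 : E2) 1) :
    Q.circleInvFun χ s ⟨Q.circleFun χ s u, circleFun_mem hk hχ s u⟩ = u := by
  obtain ⟨-, h2⟩ := apply_pol_mem hk hχ s u
  show Q.polInv s (χ.symm (Q.swap.pol (Q.σ s) (Q.swap.polInv (Q.σ s) (χ (Q.pol s u))))) = u
  rw [pol_polInv (k_swap_eq_one Q hk _) h2, χ.symm_apply_apply, polInv_pol (hk s) (coe_sphere_mem_polTarget u)]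

include hk hχ in
/-- `circleFun_circleInvFun`. [folklore] -/
theorem circleFun_circleInvFun (s : SaddlePt 2 g) (u : Metric.sphere (0 : E2) 1) :
    Q.circleFun χ s ⟨Q.circleInvFun χ s u, circleInvFun_mem hk hχ s u⟩ = u := by
  obtain ⟨-, h2⟩ := symm_apply_pol_mem hk hχ s u
  show Q.swap.polInv (Q.σ s) (χ (Q.pol s (Q.polInv s (χ.symm (Q.swap.pol (Q.σ s) u))))) = u
  rw [pol_polInv (hk s) h2, χ.apply_symm_apply, polInv_pol (k_swap_eq_one Q hk _) (coe_sphere_mem_polTarget u)]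

variable (Q χ) in
/-- **The circle map of `χ` at the saddle `s`**: `χ` along the trace circle of `s`, read in the
flow-polar charts of `s` and `σ s`, a diffeomorphism of `𝕊¹`. [cite: GriffithsHB1964Handlebody, §3] [cite: HirschDT1976, Ch. 8 §3, Thm. 3.3] -/
def circleDiffeo (s : SaddlePt 2 g) :
    Metric.sphere (0 : E2) 1 ≃ₘ⟮𝓡 1, 𝓡 1⟯ Metric.sphere (0 : E2) 1 where
  toFun u := ⟨Q.circleFun χ s u, circleFun_mem hk hχ s u⟩
  invFun u := ⟨Q.circleInvFun χ s u, circleInvFun_mem hk hχ s u⟩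
  left_inv u := Subtype.ext (circleInvFun_circleFun hk hχ s u)
  right_inv u := Subtype.ext (circleFun_circleInvFun hk hχ s u)
  contMDiff_toFun := (contMDiff_circleFun hk hχ s).codRestrict_sphere _
  contMDiff_invFun := (contMDiff_circleInvFun hk hχ s).codRestrict_sphere _

/-- The circle map in coordinates. [folklore] -/
theorem coe_circleDiffeo (s : SaddlePt 2 g) (u : Metric.sphere (0 : E2) 1) :
    ((Q.circleDiffeo hk χ hχ s u : Metric.sphere (0 : E2) 1) : E2) = Q.swap.polInv (Q.σ s) (χ (Q.pol s u)) := rfl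

/-- **`pol'_{σ s}` of the circle map is `χ ∘ pol_s`** on the unit circle. [folklore] -/
theorem pol_circleDiffeo (s : SaddlePt 2 g) (u : Metric.sphere (0 : E2) 1) :
    Q.swap.pol (Q.σ s) (Q.circleDiffeo hk χ hχ s u) = χ (Q.pol s u) := by
  rw [coe_circleDiffeo]
  exact pol_polInv (k_swap_eq_one Q hk _) (apply_pol_mem hk hχ s u).2

end Circle

/-! ### The isotopy of embedded circles and its ambient extension -/

section Embed

variable {s' : SaddlePt 2 g} (hk' : (Q.swap.DA s').k = 1)

include hk' in
/-- **The flow-polar chart along a family of circle embeddings**: for a smooth isotopy `F` of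
self-embeddings of `𝕊¹`, the maps `u ↦ pol'_{s'} (F_t u)` form a smooth isotopy of embeddings
`𝕊¹ → ∂W` (injective with injective differential, `𝕊¹` compact). [cite: HirschDT1976, Ch. 8 §1] -/
def embedIsotopy {f₀ f₁ : Metric.sphere (0 : E2) 1 → Metric.sphere (0 : E2) 1}
    (F : SmoothIsotopy (𝓡 1) (𝓡 1) f₀ f₁) :
    SmoothIsotopy (𝓡 1) (𝓡 2) (fun u => Q.swap.pol s' (f₀ u)) (fun u => Q.swap.pol s' (f₁ u)) where
  toFun t u := Q.swap.pol s' (F.toFun t u)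
  contMDiff := by
    have h1 : ContMDiff (𝓘(ℝ, ℝ).prod (𝓡 1)) 𝓘(ℝ, E2) ∞ (fun p : ℝ × Metric.sphere (0 : E2) 1 => ((F.toFun p.1 p.2 : Metric.sphere (0 : E2) 1) : E2)) :=
      contMDiff_coe_sphere.comp F.contMDiff
    intro p
    have h2 : ContMDiffAt (𝓘(ℝ, ℝ).prod (𝓡 1)) (𝓡 2) ∞
        (Q.swap.pol s' ∘ fun p : ℝ × Metric.sphere (0 : E2) 1 => ((F.toFun p.1 p.2 : Metric.sphere (0 : E2) 1) : E2)) p :=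
      ContMDiffAt.comp (I' := 𝓘(ℝ, E2)) (f := fun p : ℝ × Metric.sphere (0 : E2) 1 => ((F.toFun p.1 p.2 : Metric.sphere (0 : E2) 1) : E2))
        p (contMDiffAt_pol hk' (coe_sphere_mem_polTarget _)) (h1 p)
    exact h2
  isSmoothEmbedding t := by
    haveI : CompactSpace ((𝓡∂ (2 + 1)).boundary W) := compactSpace_boundary 2 W
    have hFt : ContMDiff (𝓡 1) (𝓡 1) ∞ (F.toFun t) := (F.isSmoothEmbedding t).contMDiff
    have hcoe : ContMDiff (𝓡 1) 𝓘(ℝ, E2) ∞ (fun u : Metric.sphere (0 : E2) 1 => ((F.toFun t u : Metric.sphere (0 : E2) 1) : E2)) :=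
      contMDiff_coe_sphere.comp hFt
    have hst : ContMDiff (𝓡 1) (𝓡 2) ∞ (fun u : Metric.sphere (0 : E2) 1 => Q.swap.pol s' (F.toFun t u)) := fun u => by
      have h2 : ContMDiffAt (𝓡 1) (𝓡 2) ∞
          (Q.swap.pol s' ∘ fun u : Metric.sphere (0 : E2) 1 => ((F.toFun t u : Metric.sphere (0 : E2) 1) : E2)) u :=
        ContMDiffAt.comp (I' := 𝓘(ℝ, E2)) (f := fun u : Metric.sphere (0 : E2) 1 => ((F.toFun t u : Metric.sphere (0 : E2) 1) : E2))
          u (contMDiffAt_pol hk' (coe_sphere_mem_polTarget _)) (hcoe u)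
      exact h2
    refine isSmoothEmbedding_of_injective_of_injective_mfderiv hst (by exact_mod_cast le_top) ?_ fun u => ?_
    · intro u v huv
      have h1 : ((F.toFun t u : Metric.sphere (0 : E2) 1) : E2) = (F.toFun t v : E2) := by
        have := congrArg (Q.swap.polInv s') huv
        rwa [polInv_pol hk' (coe_sphere_mem_polTarget _), polInv_pol hk' (coe_sphere_mem_polTarget _)] at this
      exact (F.isSmoothEmbedding t).isEmbedding.injective (Subtype.ext h1)
    · have hpol : MDifferentiableAt 𝓘(ℝ, E2) (𝓡 2) (Q.swap.pol s') ((F.toFun t u : Metric.sphere (0 : E2) 1) : E2) :=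
        (contMDiffAt_pol hk' (coe_sphere_mem_polTarget _)).mdifferentiableAt (by simp)
      have hc : MDifferentiableAt (𝓡 1) 𝓘(ℝ, E2) (fun u : Metric.sphere (0 : E2) 1 => ((F.toFun t u : Metric.sphere (0 : E2) 1) : E2)) u :=
        (hcoe u).mdifferentiableAt (by simp)
      have hcomp : (fun u : Metric.sphere (0 : E2) 1 => Q.swap.pol s' (F.toFun t u)) =
          Q.swap.pol s' ∘ fun u : Metric.sphere (0 : E2) 1 => ((F.toFun t u : Metric.sphere (0 : E2) 1) : E2) := rfl
      rw [hcomp, mfderiv_comp u hpol hc]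
      have hcoe' : (fun u : Metric.sphere (0 : E2) 1 => ((F.toFun t u : Metric.sphere (0 : E2) 1) : E2)) =
          (fun v : Metric.sphere (0 : E2) 1 => (v : E2)) ∘ F.toFun t := rfl
      have h2 : Injective (mfderiv (𝓡 1) 𝓘(ℝ, E2) (fun u : Metric.sphere (0 : E2) 1 => ((F.toFun t u : Metric.sphere (0 : E2) 1) : E2)) u) := by
        rw [hcoe', mfderiv_comp u ((contMDiff_coe_sphere (m := ∞)).mdifferentiableAt (by simp)) (hFt.mdifferentiableAt (by simp))]
        exact (mfderiv_coe_sphere_injective (n := 1) (F.toFun t u)).comp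
          (Manifold.IsImmersionAt.mfderiv_injective ((F.isSmoothEmbedding t).isImmersion.isImmersionAt u) (by simp))
      exact (mfderiv_pol_injective hk' (coe_sphere_mem_polTarget _)).comp h2
  map_zero := by funext u; simp [F.map_zero]
  map_one := by funext u; simp [F.map_one]

/-- Stages of the embedded isotopy. [folklore] -/
@[simp] theorem embedIsotopy_toFun {f₀ f₁ : Metric.sphere (0 : E2) 1 → Metric.sphere (0 : E2) 1}
    (F : SmoothIsotopy (𝓡 1) (𝓡 1) f₀ f₁) (t : ℝ) (u : Metric.sphere (0 : E2) 1) :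
    (embedIsotopy hk' F).toFun t u = Q.swap.pol s' (F.toFun t u) := rfl

end Embed

/-! ### The circle straightening -/

section Straighten

variable (hk : ∀ s, (Q.DA s).k = 1) {χ : (𝓡∂ (2 + 1)).boundary W ≃ₘ⟮𝓡 2, 𝓡 2⟯ (𝓡∂ (2 + 1)).boundary W}
  (hχ : ∀ s y, χ y ∈ P.B.traceOf (Q.σ s) ↔ y ∈ P.A.traceOf s)

include hk hχ in
/-- **The circle step at one saddle.**  If the circle map of `χ` at `s` is isotopic to the
identity, there is an ambient isotopy of `∂W`, the identity off the source of the chart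
`pol'_{σ s}` at all times, whose time-one map sends `pol'_{σ s} u` to `χ (pol_s u)` for every
unit vector `u`. [cite: HirschDT1976, Ch. 8 §1, Thm. 1.3] [cite: GriffithsHB1964Handlebody, §3] -/
theorem exists_ambientIsotopy_circleStraighten_saddle (s : SaddlePt 2 g)
    (hiso : Diffeomorph.IsIsotopic (Q.circleDiffeo hk χ hχ s) (Diffeomorph.refl (𝓡 1) (Metric.sphere (0 : E2) 1) ∞)) :
    ∃ Ψ : AmbientIsotopy (𝓡 2) ((𝓡∂ (2 + 1)).boundary W),
      (∀ u : Metric.sphere (0 : E2) 1, Ψ.toFun 1 (Q.swap.pol (Q.σ s) u) = χ (Q.pol s u)) ∧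
      (∀ t y, y ∉ Q.swap.polSource (Q.σ s) → Ψ.toFun t y = y) := by
  haveI : CompactSpace ((𝓡∂ (2 + 1)).boundary W) := compactSpace_boundary 2 W
  obtain ⟨F⟩ := hiso
  -- the isotopy from the identity to the circle map, embedded by `pol'_{σ s}`
  set G := embedIsotopy (k_swap_eq_one Q hk (Q.σ s)) F.symm with hG
  have hO : IsOpen (Q.swap.polSource (Q.σ s)) := Q.swap.isOpen_polSource _
  have hGO : ∀ t u, G.toFun t u ∈ Q.swap.polSource (Q.σ s) := fun t u =>
    pol_mem_polSource (k_swap_eq_one Q hk (Q.σ s)) (coe_sphere_mem_polTarget _)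
  obtain ⟨Ψ, hΨ, hsupp⟩ := exists_ambientIsotopy_comp_eq_of_subset G hO hGO
  refine ⟨Ψ, fun u => ?_, hsupp⟩
  have h1 := congrFun (hΨ 1 (right_mem_Icc.2 zero_le_one)) u
  simp only [comp_apply, hG, embedIsotopy_toFun, SmoothIsotopy.symm_toFun, sub_self, F.map_zero,
    Diffeomorph.coe_refl, id] at h1
  rw [h1]
  exact pol_circleDiffeo hk hχ s u

include hk hχ in
/-- **The circle straightening of a boundary diffeomorphism permuting the trace circles.**  If
every circle map of `χ` is isotopic to the identity, there is an ambient isotopy `Ψ` of `∂W`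
with `Ψ₁ (pol'_{σ s} u) = χ (pol_s u)` for all saddles `s` and unit vectors `u`, the identity
off the sources of the charts `pol'_{s'}` at all times, and mapping each such source into
itself. [cite: GriffithsHB1964Handlebody, §3] [cite: HirschDT1976, Ch. 8 §1, Thm. 1.3] -/
theorem exists_ambientIsotopy_circleStraighten
    (hiso : ∀ s, Diffeomorph.IsIsotopic (Q.circleDiffeo hk χ hχ s) (Diffeomorph.refl (𝓡 1) (Metric.sphere (0 : E2) 1) ∞)) :
    ∃ Ψ : AmbientIsotopy (𝓡 2) ((𝓡∂ (2 + 1)).boundary W),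
      (∀ s (u : Metric.sphere (0 : E2) 1), Ψ.toFun 1 (Q.swap.pol (Q.σ s) u) = χ (Q.pol s u)) ∧
      (∀ t y, (∀ s', y ∉ Q.swap.polSource s') → Ψ.toFun t y = y) ∧
      (∀ s' t, MapsTo (Ψ.toFun t) (Q.swap.polSource s') (Q.swap.polSource s')) := by
  have hfin : Finite (SaddlePt 2 g) := P.A.finite_saddlePt
  choose Ψ hΨ hsupp using fun s => exists_ambientIsotopy_circleStraighten_saddle hk hχ s (hiso s)
  -- index the isotopies by the image saddle `σ s`
  set Ψ' : SaddlePt 2 g → AmbientIsotopy (𝓡 2) ((𝓡∂ (2 + 1)).boundary W) := fun s' => Ψ (Q.σ.symm s') with hΨ'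
  have hdisj : Pairwise (Disjoint on fun s' => Q.swap.polSource s') := fun s₁ s₂ h => Q.swap.disjoint_polSource h
  have hsupp' : ∀ s' t y, y ∉ Q.swap.polSource s' → (Ψ' s').toFun t y = y := fun s' t y hy => by
    have h := hsupp (Q.σ.symm s') t y
    rw [Q.σ.apply_symm_apply] at h
    exact h hy
  obtain ⟨Φ, h1, h2, h3⟩ := AmbientIsotopy.exists_forall_eqOn_of_pairwise_disjoint Ψ' (fun s' => Q.swap.polSource s') hdisj hsupp'
  refine ⟨Φ, fun s u => ?_, h2, h3⟩
  have hmem : Q.swap.pol (Q.σ s) u ∈ Q.swap.polSource (Q.σ s) :=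
    pol_mem_polSource (k_swap_eq_one Q hk (Q.σ s)) (coe_sphere_mem_polTarget _)
  rw [h1 (Q.σ s) 1 _ hmem, hΨ']
  simp only [Equiv.symm_apply_apply]
  exact hΨ s u

end Straighten

end SaddleData

end BasinPair

end Literature.Topology.FourManifolds
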